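import Summits.CriticalPhenomena.PercolationContinuityZ3.Theorems.PercNearOneGluingNoHeavyLowerTailCornerGCILFamilies
import Summits.CriticalPhenomena.PercolationContinuityZ3.Theorems.PercNearOneGluingNoHeavyLowerTailCornerCIL
import HarnessLib

/-!
# `NoHeavyLowerTail` (stmt-CriticalPhenomena-4575) — corner programme, layer 6b:
# THE GIANT-GUARDED CUMULATIVE ISOLATION INEQUALITY (GCIL) TO LEADING ORDER AT THE RELIABLE CORNER, every level, every `|A|`

GCIL_j (the lead's guarded form of CIL; "guarded = a giant exists elsewhere", the form that survives the scale-free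
climbs that kill unguarded two-point transfers):
`P(1 ≤ |π(o)| ≤ j, some cluster apart from C(o) holds > j relays) ≤ max_{a∈A} P(|π(a)| ≤ j, some cluster apart
from C(a) holds > j relays)`.  Here, for every finite weighted support, every `A`, every level `j`:
* `Corner.leading_gcil_le` — if every `{a light, giant apart}` has order `≥ m` then
  `L_m(gcil(o)) ≤ L_m({a light, giant apart})` for some `a ∈ A`;
* `Corner.gcil_corner` — `∃ a ∈ A, ∀ γ > 0, ∀ᶠ ε → 0⁺, P_ε(gcil(o)) ≤ (1+γ)·P_ε({a light, giant apart})` along `w = 1 − ε·λ`.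
Proof = layer 6a (`gcil_no_private_triple`) + `…CornerPairCover.exists_pair_cover` + the giant-diamond endgame of
layer 5b with comparison families `R_m({t light, giant apart})`; every inclusion picks up its guard from "the other
relay is heavy and lies in another cluster" (`mem_glight_of_light_of_heavy`).  Census: kit j051514, GCIL_0 111 828
leading-order instances, 0 violations.  [folklore] bookkeeping + the landed giant diamond; nothing about the crux is
asserted (per-graph asymptotics).
-/

noncomputable section

namespace Summit.CriticalPhenomena.PercolationContinuityZ3.Theorems

open MeasureTheory Filter Topology Finset
open Literature.Probability.LatticeModels Literature.Probability.Percolation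

namespace Corner

open scoped Classical

variable {V : Type*} [Fintype V] [DecidableEq V]

/-- **GCIL at the corner, coefficient form (every level `j`, all `|A|`).** If every guarded light event
`{|π(a)| ≤ j, giant apart}` has order `≥ m` on the support, then `L_m(gcil(o)) ≤ L_m({a light, giant apart})` for some
relay `a ∈ A`. [folklore] (new here) -/
theorem leading_gcil_le (E : Finset (Sym2 V)) (lam : Sym2 V → ℝ) (hlam : ∀ e ∈ E, 0 ≤ lam e)
    (A : Finset V) (j : ℕ) (hAne : A.Nonempty) (o : V) (m : ℕ)
    (hm : ∀ a ∈ A, ∀ T ∈ E.powerset, (↑T : Set (Sym2 V)) ∈ glightEvent A j a → m ≤ (E \ T).card) :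
    ∃ a ∈ A, leading E lam (gcilEvent A j o) m ≤ leading E lam (glightEvent A j a) m := by
  -- no realizer: the coefficient vanishes
  by_cases h0 : (realizers E (gcilEvent A j o) m).Nonempty
  swap
  · obtain ⟨a, ha⟩ := hAne
    refine ⟨a, ha, ?_⟩
    have h00 : famWeight E lam (∅ : Finset (Finset (Sym2 V))) = 0 := by simp [famWeight]
    rw [leading_eq_famWeight, Finset.not_nonempty_iff_eq_empty.1 h0, h00]
    exact leading_nonneg E lam hlam _ _
  -- two relays pierce every realizer cluster (no private triple ⇒ pair cover)
  set Rl : Finset (Sym2 V) → Finset V := fun S => A ∩ clus (↑S : Set (Sym2 V)) o with hRl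
  have hRne : ∀ S ∈ realizers E (gcilEvent A j o) m, (Rl S).Nonempty := by
    intro S hS
    obtain ⟨a, ha, haC, -⟩ := exists_mem_upFamG hS
    exact ⟨a, Finset.mem_inter.2 ⟨ha, haC⟩⟩
  obtain ⟨S₁, -, S₂, -, t₁, ht₁R, t₂, ht₂R, hcov⟩ := exists_pair_cover (realizers E (gcilEvent A j o) m) Rl h0 hRne
    (fun U₁ hU₁ U₂ hU₂ U₃ hU₃ a₁ ha₁ a₂ ha₂ a₃ ha₃ n₁₂ n₁₃ n₂₁ n₂₃ n₃₁ n₃₂ =>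
      gcil_no_private_triple E m o A j hm hU₁ hU₂ hU₃ (Finset.mem_inter.1 ha₁).1 (Finset.mem_inter.1 ha₂).1
        (Finset.mem_inter.1 ha₃).1 (Finset.mem_inter.1 ha₁).2
        (fun h => n₁₂ (Finset.mem_inter.2 ⟨(Finset.mem_inter.1 ha₁).1, h⟩))
        (fun h => n₁₃ (Finset.mem_inter.2 ⟨(Finset.mem_inter.1 ha₁).1, h⟩))
        (Finset.mem_inter.1 ha₂).2
        (fun h => n₂₁ (Finset.mem_inter.2 ⟨(Finset.mem_inter.1 ha₂).1, h⟩))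
        (fun h => n₂₃ (Finset.mem_inter.2 ⟨(Finset.mem_inter.1 ha₂).1, h⟩))
        (Finset.mem_inter.1 ha₃).2
        (fun h => n₃₁ (Finset.mem_inter.2 ⟨(Finset.mem_inter.1 ha₃).1, h⟩))
        (fun h => n₃₂ (Finset.mem_inter.2 ⟨(Finset.mem_inter.1 ha₃).1, h⟩)))
  have ht₁ : t₁ ∈ A := (Finset.mem_inter.1 ht₁R).1
  have ht₂ : t₂ ∈ A := (Finset.mem_inter.1 ht₂R).1
  have hX : realizers E (gcilEvent A j o) m = upFamG E m o A j t₁ ∪ upFamG E m o A j t₂ := by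
    ext S
    rw [Finset.mem_union]
    constructor
    · intro hS
      rcases hcov S hS with h | h
      · exact Or.inl (mem_upFamG.2 ⟨hS, (Finset.mem_inter.1 h).2⟩)
      · exact Or.inr (mem_upFamG.2 ⟨hS, (Finset.mem_inter.1 h).2⟩)
    · rintro (h | h)
      · exact (mem_upFamG.1 h).1
      · exact (mem_upFamG.1 h).1
  rw [leading_eq_famWeight, hX]
  by_cases h21 : upFamG E m o A j t₂ ⊆ upFamG E m o A j t₁
  · refine ⟨t₁, ht₁, ?_⟩
    rw [Finset.union_eq_left.2 h21, leading_eq_famWeight]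
    exact famWeight_mono hlam (upFamG_subset E m o A j t₁)
  by_cases h12 : upFamG E m o A j t₁ ⊆ upFamG E m o A j t₂
  · refine ⟨t₂, ht₂, ?_⟩
    rw [Finset.union_eq_right.2 h12, leading_eq_famWeight]
    exact famWeight_mono hlam (upFamG_subset E m o A j t₂)
  have hne : t₁ ≠ t₂ := by rintro rfl; exact h12 le_rfl
  set F₁ := upFamG E m o A j t₁ with hF₁
  set F₂ := upFamG E m o A j t₂ with hF₂
  set R₁ := realizers E (glightEvent A j t₁) m
  set R₂ := realizers E (glightEvent A j t₂) m
  -- split F₂ \ F₁ by the weight of t₁, F₁ \ F₂ by the weight of t₂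
  set L₁ := (F₂ \ F₁).filter fun S : Finset (Sym2 V) => (↑S : Set (Sym2 V)) ∈ lightEvent A j t₁
  set H₁ := (F₂ \ F₁).filter fun S : Finset (Sym2 V) => ¬ ((↑S : Set (Sym2 V)) ∈ lightEvent A j t₁)
  set L₂ := (F₁ \ F₂).filter fun S : Finset (Sym2 V) => (↑S : Set (Sym2 V)) ∈ lightEvent A j t₂
  set H₂ := (F₁ \ F₂).filter fun S : Finset (Sym2 V) => ¬ ((↑S : Set (Sym2 V)) ∈ lightEvent A j t₂)
  have hsplit₁ : famWeight E lam (F₂ \ F₁) = famWeight E lam L₁ + famWeight E lam H₁ := by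
    rw [famWeight, famWeight, famWeight, ← Finset.sum_filter_add_sum_filter_not (F₂ \ F₁)
      (fun S : Finset (Sym2 V) => (↑S : Set (Sym2 V)) ∈ lightEvent A j t₁)]
  have hsplit₂ : famWeight E lam (F₁ \ F₂) = famWeight E lam L₂ + famWeight E lam H₂ := by
    rw [famWeight, famWeight, famWeight, ← Finset.sum_filter_add_sum_filter_not (F₁ \ F₂)
      (fun S : Finset (Sym2 V) => (↑S : Set (Sym2 V)) ∈ lightEvent A j t₂)]
  -- the light parts sit inside R₁ \ F₁ resp. R₂ \ F₂
  have hL₁ : L₁ ⊆ R₁ \ F₁ := by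
    intro S hS
    rw [Finset.mem_filter, Finset.mem_sdiff] at hS
    obtain ⟨⟨hS2, hS1⟩, hl⟩ := hS
    obtain ⟨hSE, -, hcard, -, z, hzA, hoz, hzj⟩ := upFamG_facts hS2
    refine Finset.mem_sdiff.2 ⟨mem_realizers.2 ⟨hSE, ⟨hl, z, hzA, fun h1z => ?_, ?_⟩, hcard⟩, hS1⟩
    · simp only [lightEvent, Set.mem_setOf_eq, filter_openConn_eq_inter] at hl
      rw [clus_eq_of_reachable h1z] at hl
      exact absurd hzj (not_lt.2 hl)
    · rw [filter_openConn_eq_inter]; exact hzj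
  have hL₂ : L₂ ⊆ R₂ \ F₂ := by
    intro S hS
    rw [Finset.mem_filter, Finset.mem_sdiff] at hS
    obtain ⟨⟨hS1, hS2⟩, hl⟩ := hS
    obtain ⟨hSE, -, hcard, -, z, hzA, hoz, hzj⟩ := upFamG_facts hS1
    refine Finset.mem_sdiff.2 ⟨mem_realizers.2 ⟨hSE, ⟨hl, z, hzA, fun h2z => ?_, ?_⟩, hcard⟩, hS2⟩
    · simp only [lightEvent, Set.mem_setOf_eq, filter_openConn_eq_inter] at hl
      rw [clus_eq_of_reachable h2z] at hl
      exact absurd hzj (not_lt.2 hl)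
    · rw [filter_openConn_eq_inter]; exact hzj
  set q₁ := famWeight E lam ((R₁ \ F₁) \ L₁)
  set q₂ := famWeight E lam ((R₂ \ F₂) \ L₂)
  have hW₁ : famWeight E lam (F₁ ∪ F₂) = famWeight E lam F₁ + famWeight E lam L₁ + famWeight E lam H₁ := by
    rw [famWeight_union_eq, hsplit₁, add_assoc]
  have hW₂ : famWeight E lam (F₁ ∪ F₂) = famWeight E lam F₂ + famWeight E lam L₂ + famWeight E lam H₂ := by
    rw [Finset.union_comm, famWeight_union_eq, hsplit₂, add_assoc]
  have hN₁ : leading E lam (glightEvent A j t₁) m = famWeight E lam F₁ + famWeight E lam L₁ + q₁ := by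
    rw [leading_eq_famWeight, famWeight_eq_add_sdiff (upFamG_subset E m o A j t₁), famWeight_eq_add_sdiff hL₁, add_assoc]
  have hN₂ : leading E lam (glightEvent A j t₂) m = famWeight E lam F₂ + famWeight E lam L₂ + q₂ := by
    rw [leading_eq_famWeight, famWeight_eq_add_sdiff (upFamG_subset E m o A j t₂), famWeight_eq_add_sdiff hL₂, add_assoc]
  by_contra hcon
  simp only [not_exists, not_and, not_le] at hcon
  have hlt₁ := hcon t₁ ht₁; have hlt₂ := hcon t₂ ht₂
  have hpq₁ : q₁ < famWeight E lam H₁ := by linarith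
  have hpq₂ : q₂ < famWeight E lam H₂ := by linarith
  have hq₁ : 0 ≤ q₁ := famWeight_nonneg hlam _
  have hq₂ : 0 ≤ q₂ := famWeight_nonneg hlam _
  -- the four giant-diamond events (x = t₂, y = t₁) and the swapped pair
  set D₁ : Set (Set (Sym2 V)) := (openConn t₂ o : Set (BondConfig V)) ∩ (lightEvent A j t₂ ∩ (lightEvent A j t₁)ᶜ)
  set Z₁ : Set (Set (Sym2 V)) := (lightEvent A j t₂)ᶜ ∩ lightEvent A j t₁
  set D₃ : Set (Set (Sym2 V)) := (openConn t₂ o : Set (BondConfig V)) ∩ ((lightEvent A j t₂)ᶜ ∩ lightEvent A j t₁)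
  set Z₂ : Set (Set (Sym2 V)) := lightEvent A j t₂ ∩ (lightEvent A j t₁)ᶜ
  set D₂ : Set (Set (Sym2 V)) := (openConn t₁ o : Set (BondConfig V)) ∩ (lightEvent A j t₁ ∩ (lightEvent A j t₂)ᶜ)
  set D₄ : Set (Set (Sym2 V)) := (openConn t₁ o : Set (BondConfig V)) ∩ ((lightEvent A j t₁)ᶜ ∩ lightEvent A j t₂)
  -- order hypotheses (each event lies in a guarded light event: the other relay is the giant)
  have ordOf : ∀ {D : Set (Set (Sym2 V))} {t : V}, t ∈ A → D ⊆ glightEvent A j t →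
      ∀ S ∈ E.powerset, (↑S : Set (Sym2 V)) ∈ D →
        m ≤ (@SDiff.sdiff (Finset (Sym2 V)) (@Finset.instSDiff (Sym2 V) fun a b => Classical.propDecidable (a = b))
          E S).card := by
    intro D t ht hD S hS hSD
    have h := hm t ht S hS (hD hSD)
    convert h using 2
    ext e; simp only [Finset.mem_sdiff]
  have o₁ := ordOf (D := D₁) ht₂ (fun S h => mem_glight_of_light_of_heavy ht₁ h.2.1 h.2.2)
  have oZ₁ := ordOf (D := Z₁) ht₁ (fun S h => mem_glight_of_light_of_heavy ht₂ h.2 h.1)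
  have o₃ := ordOf (D := D₃) ht₁ (fun S h => mem_glight_of_light_of_heavy ht₂ h.2.2 h.2.1)
  have oZ₂ := ordOf (D := Z₂) ht₂ (fun S h => mem_glight_of_light_of_heavy ht₁ h.1 h.2)
  have o₂ := ordOf (D := D₂) ht₁ (fun S h => mem_glight_of_light_of_heavy ht₂ h.2.1 h.2.2)
  have o₄ := ordOf (D := D₄) ht₂ (fun S h => mem_glight_of_light_of_heavy ht₁ h.2.2 h.2.1)
  -- giant diamonds at every ε, passed to leading coefficients
  have hGD₁ : leading E lam D₁ m * leading E lam Z₁ m ≤ leading E lam D₃ m * leading E lam Z₂ m := by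
    refine leading_mul_le_of_real_mul_le E lam hlam D₁ Z₁ D₃ Z₂ m o₁ oZ₁ o₃ oZ₂ (Filter.Eventually.of_forall fun ε => ?_)
    have h := giantDiamond (cornerWeight E lam ε) A j hne.symm o
    simp only [heavy_eq_compl] at h
    exact h
  have hGD₂ : leading E lam D₂ m * leading E lam Z₂ m ≤ leading E lam D₄ m * leading E lam Z₁ m := by
    refine leading_mul_le_of_real_mul_le E lam hlam D₂ Z₂ D₄ Z₁ m o₂ oZ₂ o₄ oZ₁ (Filter.Eventually.of_forall fun ε => ?_)
    have h := giantDiamond (cornerWeight E lam ε) A j hne o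
    simp only [heavy_eq_compl] at h
    have e1 : ((lightEvent A j t₁)ᶜ ∩ lightEvent A j t₂ : Set (BondConfig V)) = Z₂ := Set.inter_comm _ _
    have e2 : (lightEvent A j t₁ ∩ (lightEvent A j t₂)ᶜ : Set (BondConfig V)) = Z₁ := Set.inter_comm _ _
    rw [← e1, ← e2]
    exact h
  -- identifications: H₁ ⊆ realizers D₁ ⊆ realizers Z₂; realizers D₃ ⊆ (R₁ \ F₁) \ L₁; and symmetrically
  have hH₁ : H₁ ⊆ realizers E D₁ m := by
    intro S hS
    rw [Finset.mem_filter, Finset.mem_sdiff] at hS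
    obtain ⟨⟨hS2, -⟩, hh⟩ := hS
    obtain ⟨hSE, hj2, hcard, h2o, -⟩ := upFamG_facts hS2
    refine mem_realizers.2 ⟨hSE, ⟨?_, ?_, hh⟩, hcard⟩
    · exact h2o
    · simp only [lightEvent, Set.mem_setOf_eq, filter_openConn_eq_inter]; exact hj2
  have hH₂ : H₂ ⊆ realizers E D₂ m := by
    intro S hS
    rw [Finset.mem_filter, Finset.mem_sdiff] at hS
    obtain ⟨⟨hS1, -⟩, hh⟩ := hS
    obtain ⟨hSE, hj1, hcard, h1o, -⟩ := upFamG_facts hS1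
    refine mem_realizers.2 ⟨hSE, ⟨?_, ?_, hh⟩, hcard⟩
    · exact h1o
    · simp only [lightEvent, Set.mem_setOf_eq, filter_openConn_eq_inter]; exact hj1
  have hD₁Z₂ : realizers E D₁ m ⊆ realizers E Z₂ m := fun S hS => by
    obtain ⟨hSE, hD, hcard⟩ := mem_realizers.1 hS
    exact mem_realizers.2 ⟨hSE, hD.2, hcard⟩
  have hD₂Z₁ : realizers E D₂ m ⊆ realizers E Z₁ m := fun S hS => by
    obtain ⟨hSE, hD, hcard⟩ := mem_realizers.1 hS
    exact mem_realizers.2 ⟨hSE, ⟨hD.2.2, hD.2.1⟩, hcard⟩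
  have hD₃ : realizers E D₃ m ⊆ (R₁ \ F₁) \ L₁ := by
    intro S hS
    obtain ⟨hSE, hD, hcard⟩ := mem_realizers.1 hS
    obtain ⟨h2o, hh2, hl1⟩ := hD
    have hR : S ∈ R₁ := mem_realizers.2 ⟨hSE, mem_glight_of_light_of_heavy ht₂ hl1 hh2, hcard⟩
    have hnotF₁ : S ∉ F₁ := fun hF => by
      obtain ⟨-, -, -, h1o, -⟩ := upFamG_facts hF
      -- o ↔ t₁ and o ↔ t₂ would make t₂ light
      have h21 : (openGraph (↑S : Set (Sym2 V))).Reachable t₂ t₁ := h2o.trans h1o.symm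
      apply hh2
      simp only [lightEvent, Set.mem_setOf_eq, filter_openConn_eq_inter] at hl1 ⊢
      rwa [clus_eq_of_reachable h21]
    have hnotL₁ : S ∉ L₁ := fun hL => by
      rw [Finset.mem_filter, Finset.mem_sdiff] at hL
      obtain ⟨-, hj2, -, -, -⟩ := upFamG_facts hL.1.1
      apply hh2
      simp only [lightEvent, Set.mem_setOf_eq, filter_openConn_eq_inter]; exact hj2
    exact Finset.mem_sdiff.2 ⟨Finset.mem_sdiff.2 ⟨hR, hnotF₁⟩, hnotL₁⟩
  have hD₄ : realizers E D₄ m ⊆ (R₂ \ F₂) \ L₂ := by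
    intro S hS
    obtain ⟨hSE, hD, hcard⟩ := mem_realizers.1 hS
    obtain ⟨h1o, hh1, hl2⟩ := hD
    have hR : S ∈ R₂ := mem_realizers.2 ⟨hSE, mem_glight_of_light_of_heavy ht₁ hl2 hh1, hcard⟩
    have hnotF₂ : S ∉ F₂ := fun hF => by
      obtain ⟨-, -, -, h2o, -⟩ := upFamG_facts hF
      have h12 : (openGraph (↑S : Set (Sym2 V))).Reachable t₁ t₂ := h1o.trans h2o.symm
      apply hh1
      simp only [lightEvent, Set.mem_setOf_eq, filter_openConn_eq_inter] at hl2 ⊢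
      rwa [clus_eq_of_reachable h12]
    have hnotL₂ : S ∉ L₂ := fun hL => by
      rw [Finset.mem_filter, Finset.mem_sdiff] at hL
      obtain ⟨-, hj1, -, -, -⟩ := upFamG_facts hL.1.1
      apply hh1
      simp only [lightEvent, Set.mem_setOf_eq, filter_openConn_eq_inter]; exact hj1
    exact Finset.mem_sdiff.2 ⟨Finset.mem_sdiff.2 ⟨hR, hnotF₂⟩, hnotL₂⟩
  -- numbers
  have mono : ∀ {𝓕 : Finset (Finset (Sym2 V))} {D : Set (Set (Sym2 V))}, 𝓕 ⊆ realizers E D m →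
      famWeight E lam 𝓕 ≤ leading E lam D m := fun h => by rw [leading_eq_famWeight]; exact famWeight_mono hlam h
  have mono' : ∀ {𝓕 : Finset (Finset (Sym2 V))} {D : Set (Set (Sym2 V))}, realizers E D m ⊆ 𝓕 →
      leading E lam D m ≤ famWeight E lam 𝓕 := fun h => by rw [leading_eq_famWeight]; exact famWeight_mono hlam h
  set P₁ := leading E lam D₁ m
  set P₂ := leading E lam D₂ m
  set Q₁ := leading E lam D₃ m
  set Q₂ := leading E lam D₄ m
  set z₁ := leading E lam Z₁ m
  set z₂ := leading E lam Z₂ m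
  have hP₁ : famWeight E lam H₁ ≤ P₁ := mono hH₁
  have hP₂ : famWeight E lam H₂ ≤ P₂ := mono hH₂
  have hQ₁ : Q₁ ≤ q₁ := mono' hD₃
  have hQ₂ : Q₂ ≤ q₂ := mono' hD₄
  have hP₁z₂ : P₁ ≤ z₂ := (mono' hD₁Z₂).trans (mono subset_rfl)
  have hP₂z₁ : P₂ ≤ z₁ := (mono' hD₂Z₁).trans (mono subset_rfl)
  have hQ₁nn : 0 ≤ Q₁ := leading_nonneg E lam hlam D₃ m
  have hQ₂nn : 0 ≤ Q₂ := leading_nonneg E lam hlam D₄ m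
  have hgt₁ : Q₁ < P₁ := by linarith
  have hgt₂ : Q₂ < P₂ := by linarith
  -- from the two diamonds: (P₁ P₂ - Q₁ Q₂) z₁ z₂ ≤ 0, while P₂ ≤ z₁ and P₁ ≤ z₂ force z₁, z₂ > 0
  have hz₁pos : 0 < z₁ := lt_of_lt_of_le (lt_of_le_of_lt hQ₂nn hgt₂) hP₂z₁
  have hz₂pos : 0 < z₂ := lt_of_lt_of_le (lt_of_le_of_lt hQ₁nn hgt₁) hP₁z₂
  have hz₂ : 0 ≤ z₂ := hz₂pos.le
  have hP₂nn : 0 ≤ P₂ := leading_nonneg E lam hlam D₂ m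
  have h4 : (P₁ * z₁) * (P₂ * z₂) ≤ (Q₁ * z₂) * (Q₂ * z₁) :=
    mul_le_mul hGD₁ hGD₂ (mul_nonneg hP₂nn hz₂) (mul_nonneg hQ₁nn hz₂)
  have hprod : P₁ * P₂ * (z₁ * z₂) ≤ Q₁ * Q₂ * (z₁ * z₂) := by
    calc P₁ * P₂ * (z₁ * z₂) = (P₁ * z₁) * (P₂ * z₂) := by ring
      _ ≤ (Q₁ * z₂) * (Q₂ * z₁) := h4
      _ = Q₁ * Q₂ * (z₁ * z₂) := by ring
  have hPQ : P₁ * P₂ ≤ Q₁ * Q₂ := le_of_mul_le_mul_right hprod (mul_pos hz₁pos hz₂pos)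
  have hlt : Q₁ * Q₂ < P₁ * P₂ := mul_lt_mul'' hgt₁ hgt₂ hQ₁nn hQ₂nn
  linarith

/-- **GCIL at the reliable corner (every level `j`, every `|A|`).** For every finite vertex type, support `E`,
rates `λ > 0`, nonempty relay set `A`, level `j` and observer `o`: there is ONE relay `a ∈ A` such that for every
`γ > 0`, eventually as `ε → 0⁺` along `w = 1 − ε·λ`,
`P_ε(1 ≤ |π(o)| ≤ j, giant apart) ≤ (1 + γ)·P_ε(|π(a)| ≤ j, giant apart)`. [folklore] (new here) -/
theorem gcil_corner (E : Finset (Sym2 V)) (lam : Sym2 V → ℝ) (hlam : ∀ e ∈ E, 0 < lam e)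
    (A : Finset V) (j : ℕ) (hAne : A.Nonempty) (o : V) :
    ∃ a ∈ A, ∀ γ : ℝ, 0 < γ → ∀ᶠ ε in 𝓝[>] (0 : ℝ),
      (prodBernoulli (cornerWeight E lam ε)).real (gcilEvent A j o) ≤
        (1 + γ) * (prodBernoulli (cornerWeight E lam ε)).real (glightEvent A j a) := by
  have hlam' : ∀ e ∈ E, 0 ≤ lam e := fun e he => (hlam e he).le
  have bridge : ∀ {D : Set (Set (Sym2 V))} {m : ℕ},
      (∀ S ∈ E.powerset, (↑S : Set (Sym2 V)) ∈ D → m ≤ (E \ S).card) →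
      ∀ S ∈ E.powerset, (↑S : Set (Sym2 V)) ∈ D →
        m ≤ (@SDiff.sdiff (Finset (Sym2 V)) (@Finset.instSDiff (Sym2 V) fun a b => Classical.propDecidable (a = b))
          E S).card := by
    intro D m h S hS hD
    have h' := h S hS hD
    convert h' using 2
    ext e; simp only [Finset.mem_sdiff]
  by_cases hX : (E.powerset.filter fun S : Finset (Sym2 V) => (↑S : Set (Sym2 V)) ∈ gcilEvent A j o).Nonempty
  · obtain ⟨S₀, hS₀, hmin⟩ := Finset.exists_min_image _ (fun S => (E \ S).card) hX
    rw [Finset.mem_filter] at hS₀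
    set m := (E \ S₀).card with hm
    have hXord : ∀ S ∈ E.powerset, (↑S : Set (Sym2 V)) ∈ gcilEvent A j o → m ≤ (E \ S).card :=
      fun S hS hD => hmin S (Finset.mem_filter.2 ⟨hS, hD⟩)
    have hXpos : 0 < leading E lam (gcilEvent A j o) m :=
      leading_pos_of_mem_realizers hlam (mem_realizers.2 ⟨Finset.mem_powerset.1 hS₀.1, hS₀.2, rfl⟩)
    by_cases hlow : ∃ a ∈ A, ∃ S ∈ E.powerset, (↑S : Set (Sym2 V)) ∈ glightEvent A j a ∧ (E \ S).card < m
    · obtain ⟨a, ha, S₁, hS₁, hS₁D, hlt⟩ := hlow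
      have hne : (E.powerset.filter fun S : Finset (Sym2 V) => (↑S : Set (Sym2 V)) ∈ glightEvent A j a).Nonempty :=
        ⟨S₁, Finset.mem_filter.2 ⟨hS₁, hS₁D⟩⟩
      obtain ⟨S₂, hS₂, hmin₂⟩ := Finset.exists_min_image _ (fun S => (E \ S).card) hne
      rw [Finset.mem_filter] at hS₂
      set m' := (E \ S₂).card with hm'
      have hm'lt : m' < m := lt_of_le_of_lt (hmin₂ S₁ (Finset.mem_filter.2 ⟨hS₁, hS₁D⟩)) hlt
      have h₂ : ∀ S ∈ E.powerset, (↑S : Set (Sym2 V)) ∈ glightEvent A j a → m' ≤ (E \ S).card :=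
        fun S hS hD => hmin₂ S (Finset.mem_filter.2 ⟨hS, hD⟩)
      have h₁ : ∀ S ∈ E.powerset, (↑S : Set (Sym2 V)) ∈ gcilEvent A j o → m' ≤ (E \ S).card :=
        fun S hS hD => hm'lt.le.trans (hXord S hS hD)
      have hpos : 0 < leading E lam (glightEvent A j a) m' :=
        leading_pos_of_mem_realizers hlam (mem_realizers.2 ⟨Finset.mem_powerset.1 hS₂.1, hS₂.2, rfl⟩)
      have hzero : leading E lam (gcilEvent A j o) m' = 0 :=
        leading_eq_zero_of_forall fun S hS hD => ne_of_gt (hm'lt.trans_le (hXord S hS hD))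
      refine ⟨a, ha, fun γ hγ => ?_⟩
      exact eventually_real_le_mul_of_leading_le E lam hlam' _ _ m' (bridge h₁) (bridge h₂) hpos
        (by rw [hzero]; exact hpos.le) hγ
    · have hm_all : ∀ a ∈ A, ∀ T ∈ E.powerset, (↑T : Set (Sym2 V)) ∈ glightEvent A j a → m ≤ (E \ T).card := by
        intro a ha T hT hD
        by_contra hlt
        exact hlow ⟨a, ha, T, hT, hD, not_le.mp hlt⟩
      obtain ⟨a, ha, hle⟩ := leading_gcil_le E lam hlam' A j hAne o m hm_all
      refine ⟨a, ha, fun γ hγ => ?_⟩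
      exact eventually_real_le_mul_of_leading_le E lam hlam' _ _ m (bridge hXord) (bridge (hm_all a ha))
        (hXpos.trans_le hle) hle hγ
  · obtain ⟨a, ha⟩ := hAne
    refine ⟨a, ha, fun γ hγ => ?_⟩
    filter_upwards [eventually_small E lam hlam'] with ε hε
    have h0 : (prodBernoulli (cornerWeight E lam ε)).real (gcilEvent A j o) = 0 := by
      rw [real_eq_sum_powerset E lam ε hε.2]
      refine Finset.sum_eq_zero fun S hS => ?_
      rw [if_neg]
      exact fun hD => hX ⟨S, Finset.mem_filter.2 ⟨hS, hD⟩⟩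
    rw [h0]
    exact mul_nonneg (by linarith) measureReal_nonneg

end Corner

end Summit.CriticalPhenomena.PercolationContinuityZ3.Theorems

end
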